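import Summits.BirchSwinnertonDyer.Rank1Residual.Iwasawa.SelmerCardOfLevelZeroControl
import Summits.BirchSwinnertonDyer.Rank1Residual.Iwasawa.LocalTowerKernelNumericTest
import Summits.BirchSwinnertonDyer.Rank1Residual.Additive.GordCycLowerBound
import Summits.BirchSwinnertonDyer.Rank1Residual.Additive.GordRankZeroKatoComponent
import Summits.BirchSwinnertonDyer.Rank1Residual.Additive.LocalTowerKernelAtPTwistedOrdinaryTwo
import Literature.NumberTheory.EllipticCurves.PAdicBSDKatoFiniteProofs
import Literature.NumberTheory.EllipticCurves.BSDQuadraticDescentShaOddPartProofs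
import Summits.BirchSwinnertonDyer.Rank1Residual.Supersingular.DescentLowerBound
import HarnessLib

/-!
# The LOWER half in rank `0` from the typed input `CycLowerBoundAt` by CONTROL ALONE — no
# Delbourgo 2002 (A)/(B), no Schneider, no `¬ HasCM`, no non-anomalous hypothesis, no `ℓ_p`
# (team n1011, row T-CTL-EC, seat p06 GEN 9, FILE 2 — the ℚ-shaped rank-`0` CONSUMER of FILE 1)

HONEST FRAMING (cell `b2b-bsdres-*`, team n1011, verbatim): prove what is provable now; shrink each
hard class to its core with data; no claim beyond stated classes. Research route on
CONSTRUCTION-SHAPED X4 / §I N10; TOOL + CONSUMER theorems only — no definition, no named fact,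
nothing booked, no residual-map mark moved, no class closed. The typed input
`CycLowerBoundAt W p Dh` (additive-p2, `Additive/GordCycLowerBound`, OPEN) is consumed, not touched;
the UPPER half is not touched.

## What

`Additive/GordCycLowerBound[Class]` (additive-p2) turns the typed N10 input `CycLowerBoundAt W p Dh`
— "`[T^r] f_E · log_p(γ)^r = c · q · Reg_p(E, Dh)`, `L^{(r)}(E,1)/r! = q · Ω_E · Reg_∞`" — into
`Typed.MissingLowerBoundAt W p` (`ord_p #Ш_an ≤ ord_p #Ш`) THROUGH Delbourgo 2002 Thm. (A)+(B)
(`hDel : Delbourgo2002.mainTheorem`, registered fact A175, flag Del02-ThmB-ellp-anomalous), Schneider's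
non-degeneracy, `¬ W.HasCM`, `p ≥ 5` and `ReductionNonAnomalous W p`
(`ClassX4Gord.missingLowerBoundAt_rankLeOne_of_cycLowerBound`).

In RANK `0` none of this is needed. With `r = 0`: `Reg_p = 1` (`padicRegulator_eq_one_of_finite`),
so the typed input reads `f_E(0) = c · q` in `ℚ_p` (`c ∈ ℤ_p`); FILE 1's duality-free
Euler-characteristic identity (`Iwasawa/SelmerCardOfLevelZeroControl`,
`constantCoeff_mul_natCard_eq_of_no_pTorsion`: trivial level-`0` local tower kernels + `E(ℚ)[p] = 0`
+ `Sel_{p^∞}(E/ℚ)` finite ⟹ `f_E(0) · #(Sel_∞)_γ = u · #Sel_{p^∞}(E/ℚ)`) and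
`#Sel_{p^∞}(E/ℚ) = #Ш(E/ℚ)[p^∞]` (`card_selmerGroupPInfty_eq_card_primaryComponent_sha`, `E(ℚ)`
finite) give `c · q · #(Sel_∞)_γ = u · #Ш[p^∞]`, hence `ord_p q ≤ ord_p #Ш`; and
`#Ш_an = q · #tors² / ∏ c_ℓ` with `p ∤ #tors` gives `ord_p #Ш_an = ord_p q − ord_p ∏ c_ℓ ≤ ord_p #Ш`.

* `missingLowerBoundAt_rankZero_of_cycLowerBound_of_localTowerKerPrimary_eq_bot` — CORE (class-
  agnostic): `hGZK` (Gross–Zagier–Kolyvagin, as in every rank-`0` END), `W.analyticRank = 0`,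
  `¬ p ∣ #E(ℚ)_tors`, the sockets `∀ κ cyclotomic, ∀ v, 𝒦_{v,0}[p^∞] = ⊥`, ONE height datum `Dh`
  with `CycLowerBoundAt W p Dh` ⟹ `MissingLowerBoundAt W p`; `…_of_finset` (socket hypothesis on a
  finite `S ⊇ {p} ∪ {bad}`); `…_of_numeric` (`p ≥ 5`: at `v ∈ S`, `v ∤ p`, additive reduction OR the
  numeric test `p ∤ c_ℓ · #Ẽ_ns(𝔽_ℓ)`; the socket above `p` as the binder `hp0`);
* `ClassX4Gord.missingLowerBoundAt_rankZero_of_cycLowerBound` — **X4♯(G-ord), rank `0`, EVERY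
  `p ≥ 5`**: the socket above `p` is p12's T-T3B F7
  `GoodModelLine.ClassX4Gord.localTowerKerPrimary_zero_eq_bot` (no anomaly clause), `p ∤ #tors` is
  `Irr`; binders: `hX`, `hp5`, `hGZK`, `hr : W.analyticRank = 0`, place data `S / hS / hgood` (census
  columns), `Dh`, `hlow` — binder diff against
  `ClassX4Gord.missingLowerBoundAt_rankLeOne_of_cycLowerBound`: REMOVED {`hDel` (A175), Schneider,
  `hcm`, `hna`}, ADDED {`hr = 0` instead of `≤ 1`, `S / hS / hgood`}, `hlow` for ONE `Dh`;
* `ClassX4Gord.missingLowerBoundAt_rankZero_of_cycLowerBound_allNumeric` — every odd `p` (incl. `3`),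
  every bad `v ∤ p` by the numeric test;
* `ClassX3Gord.missingLowerBoundAt_rankZero_of_cycLowerBound[_allNumeric]` — X3♯(G-ord) twins with
  the explicit binder `htors : ¬ p ∣ #E(ℚ)_tors` (reducible rows may carry rational `p`-torsion).

* CAPSTONES `ClassX4Gord.bsdp_rankZero_of_katoComponent_of_cycLowerBound` (defect `2`, `ρ̄` onto, every
  odd `p`) and `ClassX4Gord.bsdp_rankZero_of_cycLeadingTerm_of_cycLowerBound` (any defect, `p ≥ 5`):
  `BSD(E,p)` by the tree ENDs `…_of_katoComponent_of_lower` / `…_of_cycLeadingTerm_of_lower` fed with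
  this lower half — the typed input(s) + PRINTED facts + census place data, no Delbourgo 2002.

Rank `1` is NOT covered (there `Sel_{p^∞}(E/ℚ)` is infinite and FILE 1's identity is vacuous); the
(M) rows wait for the `v ∋ p` socket of p12's T-T3M. Axioms standard.

References: [GreenbergLNM1716] §3 Prop. 3.8 (pp. 95–96), §4 Thm. 4.1 and Lemmas 4.2–4.3
(pp. 102–104); [Delbourgo1998] §2.5 (the typed input's shape); [Miller2011LMS] Def. 1.1 (`#Ш_an`);
[MazurTateTeitelbaum1986Invent] §II.4 (`Reg_p = 1` in rank `0`); cells/n1011/skel/T-CTL-EC.md.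
-/

noncomputable section

open scoped Classical NumberField

open WeierstrassCurve NumberField Literature.NumberTheory.EllipticCurves
  Literature.NumberTheory.EllipticCurves.ModularForms
  Literature.NumberTheory.EllipticCurves.Rank1Residual
  Literature.NumberTheory.EllipticCurves.Rank1Residual.Typed
  IsDedekindDomain Rat.HeightOneSpectrum Summit.BirchSwinnertonDyer.Rank1Residual.Iwasawa

namespace Summit.BirchSwinnertonDyer.Rank1Residual.Additive

variable (W : WeierstrassCurve ℚ) [W.IsElliptic] (p : ℕ) [hp : Fact p.Prime]

/-! ### §0 A bookkeeping lemma -/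

/-- The valuation of a natural-number cast into `ℤ_p ⊆ ℚ_p` is non-negative. [folklore] -/
private theorem valuation_natCast_nonneg (n : ℕ) : 0 ≤ ((n : ℤ_[p]) : ℚ_[p]).valuation :=
  PadicInt.valuation_coe_nonneg

/-! ### §1 CORE: the typed lower half ⟹ `MissingLowerBoundAt` in rank `0`, by control alone -/

/-- **CORE (class-agnostic, rank `0`, any prime `p`).** Let `W/ℚ` be elliptic with analytic rank `0`;
grant Gross–Zagier–Kolyvagin (`hGZK`: `rank = r_an`, `Ш` finite). Assume `p ∤ #E(ℚ)_tors`, that for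
every CYCLOTOMIC `ℤ_p`-extension `κ` the `p`-power torsion of every level-`0` local tower kernel
vanishes (`h0`, the socket family of rows T-T3CTL / T-T3B / T-GR34NA), and that the typed input
`CycLowerBoundAt W p Dh` holds for ONE height datum `Dh`. Then `Typed.MissingLowerBoundAt W p`
(`ord_p #Ш_an(E) ≤ ord_p #Ш(E)`). Mechanism: `Reg_p = 1`, `f_E(0) = c·q`; FILE 1:
`f_E(0) · #(Sel_∞)_γ = u · #Sel_{p^∞}(E/ℚ) = u · #Ш[p^∞]`; so `ord_p q ≤ ord_p #Ш` and
`ord_p #Ш_an = ord_p q − ord_p ∏c_ℓ ≤ ord_p #Ш`. No Delbourgo (A)/(B), no Schneider, no `¬CM`, no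
non-anomalous hypothesis, no duality. [cite: GreenbergLNM1716, §3 Prop. 3.8 (pp. 95–96) and §4 Thm. 4.1, Lemmas 4.2–4.3 (pp. 102–104)]
[cite: Miller2011LMS, Def. 1.1] [cite: MazurTateTeitelbaum1986Invent, §II.4] -/
theorem missingLowerBoundAt_rankZero_of_cycLowerBound_of_localTowerKerPrimary_eq_bot
    (hGZK : rank_eq_analyticRank_of_analyticRank_le_one) (hr : W.analyticRank = 0)
    (htors : ¬ p ∣ W.torsionOrder)
    (h0 : ∀ κ : ZpExtension ℚ p, κ.IsCyclotomic →
      ∀ v : HeightOneSpectrum (𝓞 ℚ), W.localTowerKerPrimary κ (v.adicCompletion ℚ) 0 = ⊥)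
    (Dh : PAdicHeightData W p) (hlow : CycLowerBoundAt W p Dh) :
    MissingLowerBoundAt W p := by
  -- Gross–Zagier–Kolyvagin in analytic rank `0`: `rank E(ℚ) = 0`, `E(ℚ)` finite, `Ш` finite
  obtain ⟨hrk, hfin⟩ := hGZK W (by omega)
  have hrank : W.mordellWeilRank = 0 := by rw [hrk, hr]
  haveI : Finite W.toAffine.Point := W.mordellWeilRank_eq_zero_iff_finite.mp hrank
  haveI : Finite W.sha := hfin
  haveI hfinp : Finite (AddCommGroup.primaryComponent W.sha p) := inferInstance
  have hSel : Finite (W.selmerGroupPInfty p) := W.finite_selmerGroupPInfty_of_finite_primaryComponent p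
  have hK := forall_smul_eq_zero_imp_of_not_dvd_torsionOrder W (p := p) htors
  -- the cyclotomic setting, a dual datum, a generator of the characteristic ideal
  obtain ⟨κ, hκ, γ, hγ, hγ'⟩ := exists_isCyclotomic_isTopGenerator_isCyclotomicVariable_holds p
  obtain ⟨D⟩ := W.nonempty_selmerDualData_holds κ γ hγ
  haveI : (Module.charIdeal (IwasawaAlgebra p) D.X).IsPrincipal := charIdeal_isPrincipal_holds p D.X
  obtain ⟨fE, hchar⟩ := Submodule.IsPrincipal.principal (Module.charIdeal (IwasawaAlgebra p) D.X)
  have hchar' : D.charIdeal = Ideal.span {fE} := hchar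
  -- FILE 1: `f_E(0) · #(Sel_∞)_γ = u · #Sel_{p^∞}(E/ℚ)`
  obtain ⟨-, -, -, hH1, hf0, u, hu⟩ :=
    constantCoeff_mul_natCard_eq_of_no_pTorsion W D hγ hSel hK fE hchar' (h0 κ hκ)
  -- the typed input in rank `0`: `f_E(0) = c · q`
  obtain ⟨q, c, hlead, hlowEq⟩ := hlow κ γ hκ hγ hγ' D fE hchar'
  have hReg : padicRegulator Dh = 1 := padicRegulator_eq_one_of_finite W p Dh
  rw [hrank, pow_zero, mul_one, hReg, mul_one] at hlowEq
  have hcoeff0 : (PowerSeries.coeff 0 fE : ℤ_[p]) = PowerSeries.constantCoeff fE := by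
    rw [PowerSeries.coeff_zero_eq_constantCoeff]
  rw [hcoeff0] at hlowEq
  -- abbreviations in `ℚ_p`
  set A : ℚ_[p] := ((Nat.card (IwasawaDual.EndCoinvariants (W.conjSelmerInfty κ γ - 1)) : ℤ_[p]) :
    ℚ_[p]) with hA_def
  set N : ℚ_[p] := ((Nat.card ↥(W.selmerGroupPInfty p) : ℤ_[p]) : ℚ_[p]) with hN_def
  set cQ : ℚ_[p] := ((c : ℤ_[p]) : ℚ_[p]) with hcQ_def
  set uQ : ℚ_[p] := ((u : ℤ_[p]) : ℚ_[p]) with huQ_def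
  -- `c · q · A = u · N` in `ℚ_p`
  have huQ : ((PowerSeries.constantCoeff fE : ℤ_[p]) : ℚ_[p]) * A = uQ * N := by
    rw [hA_def, huQ_def, hN_def, ← PadicInt.coe_mul, hu, PadicInt.coe_mul]
  have key : cQ * (q : ℚ_[p]) * A = uQ * N := by rw [← hlowEq]; exact huQ
  -- non-vanishing
  have hu0 : uQ ≠ 0 := coe_units_ne_zero p u
  have hNpos : 0 < Nat.card ↥(W.selmerGroupPInfty p) := by
    haveI := hSel; exact Nat.card_pos
  have hN0 : N ≠ 0 := by
    rw [hN_def, PadicInt.coe_natCast]; exact_mod_cast hNpos.ne'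
  have hApos : 0 < Nat.card (IwasawaDual.EndCoinvariants (W.conjSelmerInfty κ γ - 1)) := by
    haveI := hH1; exact Nat.card_pos
  have hA0 : A ≠ 0 := by
    rw [hA_def, PadicInt.coe_natCast]; exact_mod_cast hApos.ne'
  have hrhs : uQ * N ≠ 0 := mul_ne_zero hu0 hN0
  have hlhs : cQ * (q : ℚ_[p]) * A ≠ 0 := by rw [key]; exact hrhs
  have hc0 : cQ ≠ 0 := fun h ↦ hlhs (by rw [h]; ring)
  have hqQ : ((q : ℚ) : ℚ_[p]) ≠ 0 := fun h ↦ hlhs (by rw [h]; ring)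
  have hq0 : q ≠ 0 := fun h ↦ hqQ (by rw [h, Rat.cast_zero])
  -- valuations: `v(c) + v(q) + v(A) = v(N)`, `v(c), v(A) ≥ 0`
  have hval := congrArg Padic.valuation key
  rw [Padic.valuation_mul (mul_ne_zero hc0 hqQ) hA0, Padic.valuation_mul hc0 hqQ,
    Padic.valuation_mul hu0 hN0, huQ_def, valuation_coe_units_eq_zero, zero_add,
    Padic.valuation_ratCast] at hval
  have hcnn : 0 ≤ cQ.valuation := PadicInt.valuation_coe_nonneg
  have hAnn : 0 ≤ A.valuation := valuation_natCast_nonneg p _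
  have hNval : N.valuation = (padicValNat p W.shaOrder : ℤ) := by
    rw [hN_def, PadicInt.coe_natCast, Padic.valuation_natCast,
      W.card_selmerGroupPInfty_eq_card_primaryComponent_sha p, padicValNat_card_addPrimaryComponent,
      WeierstrassCurve.shaOrder]
  have hqle : padicValRat p q ≤ (padicValNat p W.shaOrder : ℤ) := by
    rw [← hNval]; linarith
  -- the analytic order of `Ш`
  set s : ℚ := q * (W.torsionOrder : ℚ) ^ 2 / (W.tamagawaProduct : ℚ) with hs_def
  refine ⟨s, shaAn_eq_of_leadingLCoeff_eq W hlead, ?_⟩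
  have hT0 : W.torsionOrder ≠ 0 := (W.torsionOrder_pos_holds).ne'
  have hTq : (W.torsionOrder : ℚ) ≠ 0 := by exact_mod_cast hT0
  have hPq : (W.tamagawaProduct : ℚ) ≠ 0 := by
    exact_mod_cast (W.tamagawaProduct_pos_holds : 0 < W.tamagawaProduct).ne'
  have htorsval : padicValNat p W.torsionOrder = 0 :=
    padicValNat.eq_zero_of_not_dvd htors
  rw [hs_def, padicValRat.div (mul_ne_zero hq0 (pow_ne_zero 2 hTq)) hPq,
    padicValRat.mul hq0 (pow_ne_zero 2 hTq), padicValRat.pow, padicValRat.of_nat,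
    padicValRat.of_nat, htorsval]
  have htam : (0 : ℤ) ≤ (padicValNat p W.tamagawaProduct : ℤ) := by exact_mod_cast Nat.zero_le _
  push_cast at hqle htam ⊢
  linarith

/-- **CORE, finite-set form**: the socket hypothesis on a finite set `S` of places containing the
place above `p` and every bad place (good `v ∤ p` are free, Greenberg's Lemma 3.3).
[cite: GreenbergLNM1716, §3 Prop. 3.8 (pp. 95–96), Lemma 3.3 (p. 87) and §4 Thm. 4.1 (pp. 102–104)] [cite: Miller2011LMS, Def. 1.1] -/
theorem missingLowerBoundAt_rankZero_of_cycLowerBound_of_finset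
    (hGZK : rank_eq_analyticRank_of_analyticRank_le_one) (hr : W.analyticRank = 0)
    (htors : ¬ p ∣ W.torsionOrder) (S : Finset (HeightOneSpectrum (𝓞 ℚ)))
    (hS : ∀ κ : ZpExtension ℚ p, κ.IsCyclotomic →
      ∀ v ∈ S, W.localTowerKerPrimary κ (v.adicCompletion ℚ) 0 = ⊥)
    (hgood : ∀ v ∉ S, (p : 𝓞 ℚ) ∉ v.asIdeal ∧ W.HasGoodReductionAt v)
    (Dh : PAdicHeightData W p) (hlow : CycLowerBoundAt W p Dh) :
    MissingLowerBoundAt W p :=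
  missingLowerBoundAt_rankZero_of_cycLowerBound_of_localTowerKerPrimary_eq_bot W p hGZK hr htors
    (fun κ hκ ↦ localTowerKerPrimary_zero_eq_bot_of_finset W κ S (hS κ hκ) hgood) Dh hlow

/-- **CORE, numeric form (`p ≥ 5`, `W` globally minimal)**: at each `v ∈ S` not above `p`, EITHER
additive reduction (row T-T3CTL F2b: `E(ℚ_ℓ^{nr})[p^∞] = 0`, `p ≥ 5`) OR the numeric test
`p ∤ c_ℓ · #Ẽ_ns(𝔽_ℓ)` (F2c); above `p` the socket is the binder `hp0` (discharged class-wide on the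
(G-ord) loci by T-T3B F7, see the class ENDs below).
[cite: GreenbergLNM1716, §3 Prop. 3.8 and Remark (pp. 95–96), p. 88, and §4 Thm. 4.1 (pp. 102–104)] [cite: Miller2011LMS, Def. 1.1] -/
theorem missingLowerBoundAt_rankZero_of_cycLowerBound_of_numeric [W.IsGloballyMinimal]
    (hp5 : 5 ≤ p) (hGZK : rank_eq_analyticRank_of_analyticRank_le_one) (hr : W.analyticRank = 0)
    (htors : ¬ p ∣ W.torsionOrder) (S : Finset (HeightOneSpectrum (𝓞 ℚ)))
    (hS : ∀ v ∈ S, (p : 𝓞 ℚ) ∉ v.asIdeal → W.HasAdditiveReductionAt v ∨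
      ((primesEquiv v : ℕ) ≠ p ∧ ¬ p ∣ (W.baseChange (v.adicCompletion ℚ)).localTamagawaNumber
        (v.adicCompletionIntegers ℚ) * reductionPointCount W (primesEquiv v : ℕ)))
    (hp0 : ∀ (κ : ZpExtension ℚ p), ∀ v ∈ S, (p : 𝓞 ℚ) ∈ v.asIdeal →
      W.localTowerKerPrimary κ (v.adicCompletion ℚ) 0 = ⊥)
    (hgood : ∀ v ∉ S, (p : 𝓞 ℚ) ∉ v.asIdeal ∧ W.HasGoodReductionAt v)
    (Dh : PAdicHeightData W p) (hlow : CycLowerBoundAt W p Dh) :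
    MissingLowerBoundAt W p := by
  refine missingLowerBoundAt_rankZero_of_cycLowerBound_of_finset W p hGZK hr htors S
    (fun κ _ v hv ↦ ?_) hgood Dh hlow
  by_cases hpv : (p : 𝓞 ℚ) ∈ v.asIdeal
  · exact hp0 κ v hv hpv
  · rcases hS v hv hpv with hadd | ⟨hne, hnum⟩
    · exact localTowerKerPrimary_zero_eq_bot_of_hasAdditiveReductionAt W v κ hpv hp5 hadd
    · haveI : Fact (Nat.Prime (primesEquiv v : ℕ)) := ⟨(primesEquiv v).2⟩
      exact localTowerKerPrimary_zero_eq_bot_of_not_dvd W κ v (primesEquiv v : ℕ) rfl hne hpv hnum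

/-- **CORE, all-numeric form (any prime `p`, `W` globally minimal)**: every `v ∈ S` not above `p`
passes the numeric test `primesEquiv v ≠ p ∧ p ∤ c_ℓ · #Ẽ_ns(𝔽_ℓ)` (the shape for `p = 3`, where an
additive `ℓ ≠ 3` with `c_ℓ ∈ {1, 2, 4}` passes since `#Ẽ_ns(𝔽_ℓ) = ℓ`).
[cite: GreenbergLNM1716, §3 Prop. 3.8 and Remark (pp. 95–96) and §4 Thm. 4.1 (pp. 102–104)] [cite: Miller2011LMS, Def. 1.1] -/
theorem missingLowerBoundAt_rankZero_of_cycLowerBound_of_allNumeric [W.IsGloballyMinimal]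
    (hGZK : rank_eq_analyticRank_of_analyticRank_le_one) (hr : W.analyticRank = 0)
    (htors : ¬ p ∣ W.torsionOrder) (S : Finset (HeightOneSpectrum (𝓞 ℚ)))
    (hS : ∀ v ∈ S, (p : 𝓞 ℚ) ∉ v.asIdeal →
      (primesEquiv v : ℕ) ≠ p ∧ ¬ p ∣ (W.baseChange (v.adicCompletion ℚ)).localTamagawaNumber
        (v.adicCompletionIntegers ℚ) * reductionPointCount W (primesEquiv v : ℕ))
    (hp0 : ∀ (κ : ZpExtension ℚ p), ∀ v ∈ S, (p : 𝓞 ℚ) ∈ v.asIdeal →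
      W.localTowerKerPrimary κ (v.adicCompletion ℚ) 0 = ⊥)
    (hgood : ∀ v ∉ S, (p : 𝓞 ℚ) ∉ v.asIdeal ∧ W.HasGoodReductionAt v)
    (Dh : PAdicHeightData W p) (hlow : CycLowerBoundAt W p Dh) :
    MissingLowerBoundAt W p := by
  refine missingLowerBoundAt_rankZero_of_cycLowerBound_of_finset W p hGZK hr htors S
    (fun κ _ v hv ↦ ?_) hgood Dh hlow
  by_cases hpv : (p : 𝓞 ℚ) ∈ v.asIdeal
  · exact hp0 κ v hv hpv
  · obtain ⟨hne, hnum⟩ := hS v hv hpv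
    haveI : Fact (Nat.Prime (primesEquiv v : ℕ)) := ⟨(primesEquiv v).2⟩
    exact localTowerKerPrimary_zero_eq_bot_of_not_dvd W κ v (primesEquiv v : ℕ) rfl hne hpv hnum

/-! ### §2 CLASS ENDS: X4♯(G-ord) and X3♯(G-ord), rank `0` -/

variable {W p} in
/-- **X4♯(G-ord), rank `0`, EVERY `p ≥ 5`: the lower half from the typed input by control alone.**
(`ClassX4Gord = ClassX4 ∧ TypeGOrd`, `ClassX4 = p ≠ 2 ∧ Addv ∧ Irr`.) The socket above `p` is p12's
T-T3B F7 `GoodModelLine.ClassX4Gord.localTowerKerPrimary_zero_eq_bot` (every `ℤ_p`-extension, no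
anomaly clause); `p ∤ #E(ℚ)_tors` is `Irr` (`Supersingular.not_dvd_torsionOrder_of_irr`); at the bad
places away from `p`: additive (free, `p ≥ 5`) or the numeric test. Binders: `hX`, `hp5`, `hGZK`,
`hr`, `S / hS / hgood`, `Dh`, `hlow` — NO `hDel` (Delbourgo 2002), NO Schneider, NO `hcm`, NO `hna`. X4 stays
CONSTRUCTION-SHAPED; the typed input stays OPEN; nothing booked.
[cite: GreenbergLNM1716, §3 Prop. 3.8 (pp. 95–96), Lemma 3.4 (p. 89) and §4 Thm. 4.1 (pp. 102–104)] [cite: Miller2011LMS, Def. 1.1] -/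
theorem ClassX4Gord.missingLowerBoundAt_rankZero_of_cycLowerBound [W.IsGloballyMinimal]
    (hX : ClassX4Gord W p) (hp5 : 5 ≤ p) (hGZK : rank_eq_analyticRank_of_analyticRank_le_one)
    (hr : W.analyticRank = 0) (S : Finset (HeightOneSpectrum (𝓞 ℚ)))
    (hS : ∀ v ∈ S, (p : 𝓞 ℚ) ∉ v.asIdeal → W.HasAdditiveReductionAt v ∨
      ((primesEquiv v : ℕ) ≠ p ∧ ¬ p ∣ (W.baseChange (v.adicCompletion ℚ)).localTamagawaNumber
        (v.adicCompletionIntegers ℚ) * reductionPointCount W (primesEquiv v : ℕ)))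
    (hgood : ∀ v ∉ S, (p : 𝓞 ℚ) ∉ v.asIdeal ∧ W.HasGoodReductionAt v)
    (Dh : PAdicHeightData W p) (hlow : CycLowerBoundAt W p Dh) :
    MissingLowerBoundAt W p :=
  missingLowerBoundAt_rankZero_of_cycLowerBound_of_numeric W p hp5 hGZK hr
    (Supersingular.not_dvd_torsionOrder_of_irr W p hX.1.2.2) S hS
    (fun κ _ _ hpv ↦ GoodModelLine.ClassX4Gord.localTowerKerPrimary_zero_eq_bot hX hpv κ) hgood Dh
    hlow

variable {W p} in
/-- **X4♯(G-ord), rank `0`, EVERY odd `p` (incl. `p = 3`): the lower half from the typed input by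
control alone, all bad places away from `p` by the numeric test.** X4 stays CONSTRUCTION-SHAPED; the
typed input stays OPEN; nothing booked.
[cite: GreenbergLNM1716, §3 Prop. 3.8 (pp. 95–96), Lemma 3.4 (p. 89) and §4 Thm. 4.1 (pp. 102–104)] [cite: Miller2011LMS, Def. 1.1] -/
theorem ClassX4Gord.missingLowerBoundAt_rankZero_of_cycLowerBound_allNumeric [W.IsGloballyMinimal]
    (hX : ClassX4Gord W p) (hGZK : rank_eq_analyticRank_of_analyticRank_le_one)
    (hr : W.analyticRank = 0) (S : Finset (HeightOneSpectrum (𝓞 ℚ)))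
    (hS : ∀ v ∈ S, (p : 𝓞 ℚ) ∉ v.asIdeal →
      (primesEquiv v : ℕ) ≠ p ∧ ¬ p ∣ (W.baseChange (v.adicCompletion ℚ)).localTamagawaNumber
        (v.adicCompletionIntegers ℚ) * reductionPointCount W (primesEquiv v : ℕ))
    (hgood : ∀ v ∉ S, (p : 𝓞 ℚ) ∉ v.asIdeal ∧ W.HasGoodReductionAt v)
    (Dh : PAdicHeightData W p) (hlow : CycLowerBoundAt W p Dh) :
    MissingLowerBoundAt W p :=
  missingLowerBoundAt_rankZero_of_cycLowerBound_of_allNumeric W p hGZK hr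
    (Supersingular.not_dvd_torsionOrder_of_irr W p hX.1.2.2) S hS
    (fun κ _ _ hpv ↦ GoodModelLine.ClassX4Gord.localTowerKerPrimary_zero_eq_bot hX hpv κ) hgood Dh
    hlow

variable {W p} in
/-- **X3♯(G-ord), rank `0`, EVERY `p ≥ 5`, `p ∤ #E(ℚ)_tors` explicit: the lower half from the typed
input by control alone.** (`ClassX3Gord = ClassX3 ∧ TypeGOrd`; reducible rows may carry rational
`p`-torsion, hence the binder `htors`.) Socket above `p`: T-T3B F7
`GoodModelLine.ClassX3Gord.localTowerKerPrimary_zero_eq_bot`. X3 stays as labelled; nothing booked.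
[cite: GreenbergLNM1716, §3 Prop. 3.8 (pp. 95–96), Lemma 3.4 (p. 89) and §4 Thm. 4.1 (pp. 102–104)] [cite: Miller2011LMS, Def. 1.1] -/
theorem ClassX3Gord.missingLowerBoundAt_rankZero_of_cycLowerBound [W.IsGloballyMinimal]
    (hX : ClassX3Gord W p) (hp5 : 5 ≤ p) (hGZK : rank_eq_analyticRank_of_analyticRank_le_one)
    (hr : W.analyticRank = 0) (htors : ¬ p ∣ W.torsionOrder) (S : Finset (HeightOneSpectrum (𝓞 ℚ)))
    (hS : ∀ v ∈ S, (p : 𝓞 ℚ) ∉ v.asIdeal → W.HasAdditiveReductionAt v ∨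
      ((primesEquiv v : ℕ) ≠ p ∧ ¬ p ∣ (W.baseChange (v.adicCompletion ℚ)).localTamagawaNumber
        (v.adicCompletionIntegers ℚ) * reductionPointCount W (primesEquiv v : ℕ)))
    (hgood : ∀ v ∉ S, (p : 𝓞 ℚ) ∉ v.asIdeal ∧ W.HasGoodReductionAt v)
    (Dh : PAdicHeightData W p) (hlow : CycLowerBoundAt W p Dh) :
    MissingLowerBoundAt W p :=
  have hp2 : p ≠ 2 := by omega
  missingLowerBoundAt_rankZero_of_cycLowerBound_of_numeric W p hp5 hGZK hr htors S hS
    (fun κ _ _ hpv ↦ GoodModelLine.ClassX3Gord.localTowerKerPrimary_zero_eq_bot hp2 hX hpv κ) hgood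
    Dh hlow

variable {W p} in
/-- **X3♯(G-ord), rank `0`, EVERY odd `p` (incl. `3`), `p ∤ #E(ℚ)_tors` explicit, all bad places away
from `p` by the numeric test.** X3 stays as labelled; nothing booked.
[cite: GreenbergLNM1716, §3 Prop. 3.8 (pp. 95–96), Lemma 3.4 (p. 89) and §4 Thm. 4.1 (pp. 102–104)] [cite: Miller2011LMS, Def. 1.1] -/
theorem ClassX3Gord.missingLowerBoundAt_rankZero_of_cycLowerBound_allNumeric [W.IsGloballyMinimal]
    (hp2 : p ≠ 2) (hX : ClassX3Gord W p) (hGZK : rank_eq_analyticRank_of_analyticRank_le_one)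
    (hr : W.analyticRank = 0) (htors : ¬ p ∣ W.torsionOrder) (S : Finset (HeightOneSpectrum (𝓞 ℚ)))
    (hS : ∀ v ∈ S, (p : 𝓞 ℚ) ∉ v.asIdeal →
      (primesEquiv v : ℕ) ≠ p ∧ ¬ p ∣ (W.baseChange (v.adicCompletion ℚ)).localTamagawaNumber
        (v.adicCompletionIntegers ℚ) * reductionPointCount W (primesEquiv v : ℕ))
    (hgood : ∀ v ∉ S, (p : 𝓞 ℚ) ∉ v.asIdeal ∧ W.HasGoodReductionAt v)
    (Dh : PAdicHeightData W p) (hlow : CycLowerBoundAt W p Dh) :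
    MissingLowerBoundAt W p :=
  missingLowerBoundAt_rankZero_of_cycLowerBound_of_allNumeric W p hGZK hr htors S hS
    (fun κ _ _ hpv ↦ GoodModelLine.ClassX3Gord.localTowerKerPrimary_zero_eq_bot hp2 hX hpv κ) hgood
    Dh hlow

/-! ### §3 CAPSTONES: `BSD(E,p)` on rank-`0` X4♯(G-ord) rows from ONE typed input -/

variable {W p} in
/-- **X4♯(G-ord) ∩ `I₀*` (defect `e = 2`), `r_an = 0`, `ρ̄_{E,p}` onto, EVERY odd `p` (at `p = 3`:
`Ram`): `BSD(E,p)` from PRINTED facts (Kato 2004 Thm. 17.4 (3) on the `ω^{(p−1)/2}`-component `hK`,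
Delbourgo 1998 Prop. 4 `hDel98`, Gross–Zagier–Kolyvagin `hGZK`, modularity `hmod`/`hmodD`), census
place data (`S / hS / hgood`, every bad `v ∤ p` by the numeric test) and the ONE typed input
`CycLowerBoundAt W p Dh`** — the tree END `ClassX4Gord.bsdp_rankZero_of_katoComponent_of_lower` fed
with this file's (B)-free lower half. Compared with the road through
`ClassX4Gord.missingLowerBoundAt_rankLeOne_of_cycLowerBound`: NO Delbourgo 2002 (A)/(B) (A175), NO
Schneider, NO `¬ HasCM`, NO `ReductionNonAnomalous`. X4 stays CONSTRUCTION-SHAPED (the typed input is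
OPEN); nothing booked. [cite: Kato2004Asterisque, Thm. 17.4 (3) (p. 273)] [cite: Delbourgo1998, Prop. 4 (p. 144)]
[cite: GreenbergLNM1716, §3 Prop. 3.8 (pp. 95–96) and §4 Thm. 4.1 (pp. 102–104)] [cite: Miller2011LMS, Def. 1.1] -/
theorem ClassX4Gord.bsdp_rankZero_of_katoComponent_of_cycLowerBound [W.IsGloballyMinimal]
    (hK : Kato2004.charIdeal_dvd_padicLFunctionBranch_component_of_surjective)
    (hDel98 : Delbourgo1998.prop4_rankZero_pow_dvd_constantCoeff)
    (hGZK : rank_eq_analyticRank_of_analyticRank_le_one) (hmod : hasEntireLFunction_rat)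
    (hmodD : nonempty_modularParametrizationData)
    (hX : ClassX4Gord W p) (he : semistabilityIndex W p = 2) (hr : W.analyticRank = 0)
    (hsurj : Surj W p) (hram3 : p = 3 → Ram W p) (S : Finset (HeightOneSpectrum (𝓞 ℚ)))
    (hS : ∀ v ∈ S, (p : 𝓞 ℚ) ∉ v.asIdeal →
      (primesEquiv v : ℕ) ≠ p ∧ ¬ p ∣ (W.baseChange (v.adicCompletion ℚ)).localTamagawaNumber
        (v.adicCompletionIntegers ℚ) * reductionPointCount W (primesEquiv v : ℕ))
    (hgood : ∀ v ∉ S, (p : 𝓞 ℚ) ∉ v.asIdeal ∧ W.HasGoodReductionAt v)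
    (Dh : PAdicHeightData W p) (hlow : CycLowerBoundAt W p Dh) : BSDp W p :=
  ClassX4Gord.bsdp_rankZero_of_katoComponent_of_lower hK hDel98 hGZK hmod hmodD hX he hr hsurj hram3
    (ClassX4Gord.missingLowerBoundAt_rankZero_of_cycLowerBound_allNumeric hX hGZK hr S hS hgood Dh
      hlow)

variable {W p} in
/-- **X4♯(G-ord), ANY defect, `p ≥ 5`, `r_an = 0`: `BSD(E,p)` from the TWO typed cyclotomic inputs
at `T = 0` — the upper one `CycLeadingTermAt W p` and the lower one `CycLowerBoundAt W p Dh` — plus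
Delbourgo 1998 Prop. 4 (`hDel98`), GZK, modularity and census place data (additive bad places free,
the others by the numeric test)**: the tree END `ClassX4Gord.bsdp_rankZero_of_cycLeadingTerm_of_lower`
fed with this file's (B)-free lower half; NO Delbourgo 2002, NO Schneider, NO `¬CM`, NO `hna`. X4 stays
CONSTRUCTION-SHAPED (both typed inputs OPEN off the defect-2 rows); nothing booked.
[cite: Delbourgo1998, Prop. 4 (p. 144)] [cite: GreenbergLNM1716, §3 Prop. 3.8 (pp. 95–96) and §4 Thm. 4.1 (pp. 102–104)]
[cite: Miller2011LMS, Def. 1.1] -/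
theorem ClassX4Gord.bsdp_rankZero_of_cycLeadingTerm_of_cycLowerBound [W.IsGloballyMinimal]
    (hDel98 : Delbourgo1998.prop4_rankZero_pow_dvd_constantCoeff)
    (hGZK : rank_eq_analyticRank_of_analyticRank_le_one) (hmod : hasEntireLFunction_rat)
    (hX : ClassX4Gord W p) (hp5 : 5 ≤ p) (hr : W.analyticRank = 0) (hLT : CycLeadingTermAt W p)
    (S : Finset (HeightOneSpectrum (𝓞 ℚ)))
    (hS : ∀ v ∈ S, (p : 𝓞 ℚ) ∉ v.asIdeal → W.HasAdditiveReductionAt v ∨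
      ((primesEquiv v : ℕ) ≠ p ∧ ¬ p ∣ (W.baseChange (v.adicCompletion ℚ)).localTamagawaNumber
        (v.adicCompletionIntegers ℚ) * reductionPointCount W (primesEquiv v : ℕ)))
    (hgood : ∀ v ∉ S, (p : 𝓞 ℚ) ∉ v.asIdeal ∧ W.HasGoodReductionAt v)
    (Dh : PAdicHeightData W p) (hlow : CycLowerBoundAt W p Dh) : BSDp W p :=
  ClassX4Gord.bsdp_rankZero_of_cycLeadingTerm_of_lower hDel98 hGZK hmod hX hp5 hr hLT
    (ClassX4Gord.missingLowerBoundAt_rankZero_of_cycLowerBound hX hp5 hGZK hr S hS hgood Dh hlow)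

end Summit.BirchSwinnertonDyer.Rank1Residual.Additive

end
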